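import Literature.Probability.LatticeModels.MedialCornerTrailWinding
import HarnessLib

/-!
# Corner walks along lattice paths: virtual dart paths of the oriented medial graph of `ℤ²`

Topic `Literature/Probability/LatticeModels`; companion of `MedialCornerTrailWinding.lean` and
`MedialExplorationPrefixWinding.lean` (closed corner trails; the winding of an exploration prefix closed by a
VIRTUAL path is read off the closing path). This file builds virtual dart paths from lattice vertex paths —
the raw material of closing paths ("escape through the boundary", Duminil-Copin–Hongler–Nolin 2011, Lemma
12): to travel from a vertex `z` to its neighbour `z + u_k` one leaves `z` by the corner `(z, k + 3)` (whose
target edge is the `k`-th edge at `z`) and FOLLOWS the edge (right turn) into the arrival corner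
`(z + u_k, k + 2)`; at a vertex one turns LEFT from the arrival corner to the next departure corner.

* `IsSucc a b` — `b` is the left or the right successor of `a`; `addN`, `fanL z a n` — the `n + 1` corners
  `(z, a), (z, a+1), …, (z, a+n)` (left turns around `z`);
* `cornerWalk z a ks` — the corner list of the lattice path from `z` with direction list `ks`, entered at
  the arrival index `a`: at each vertex the left fan from the arrival corner to the departure corner, then the
  right turn along the edge; it ends just before arriving at the final vertex, whose arrival corner
  `(z_final, k_last + 2)` is the right successor of the last corner emitted (`cornerWalk_append`: walks
  concatenate);
* structure: `cornerWalk_ne_nil`, `head?`, `isChain_cornerWalk` (consecutive corners are successors),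
  `isSucc_getLast_cornerWalk` (the arrival corner at the end vertex continues the chain),
  `fst_mem_pathVerts` (every corner sits at a non-final vertex of the path), `nodup_cornerWalk` (distinct
  corners as soon as the non-final vertices are distinct);
* signs: `sgn`, `walkSign` (signed quarter turns along a corner list, additive: `walkSign_append`),
  `walkTurns` / `walkSign_cornerWalk` (the signed turns of a walk, vertex by vertex), `walkTurns_replicate` (a
  straight run has no net turn), `walkTurns_append`;
* medial coordinates: `cpos_fst_bounds` — a corner at vertex `v` has medial coordinates
  `(v₀ + v₁ - ε, v₁ - v₀ + ε')`, `ε, ε' ∈ {0, 1}` (for extreme-dart bookkeeping).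

Pure list combinatorics; everything is proved.

## References

* S. Smirnov, *Conformal invariance in random cluster models. I*, Ann. of Math. 172 (2010), §4, Fig. 5
  (the medial lattice and its corners). [Smirnov2010]
* H. Duminil-Copin, C. Hongler, P. Nolin, Comm. Pure Appl. Math. 64 (2011), Lemma 12.
  [DuminilCopinHonglerNolin2011]
-/

namespace Literature.Probability.LatticeModels

open MedialTrail

/-! ### Successors and left fans -/

/-- `b` is a successor of the corner `a`: the left one (cross the target edge) or the right one (follow it).
[cite: Smirnov2010, §4] -/
def IsSucc (a b : Site 2 × Fin 4) : Prop := b = leftSucc a ∨ b = rightSucc a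

/-- Iterated left turn of a face index: `addN a n = a + n` in `Fin 4`, by the recursion of `fanL`. [folklore] -/
def addN : Fin 4 → ℕ → Fin 4
  | a, 0 => a
  | a, n + 1 => addN (a + 1) n

/-- `addN a ((x - a).val) = x`: turning left `x - a` times from `a` reaches `x` (decided). [folklore] -/
theorem addN_sub_val (a x : Fin 4) : addN a (x - a).val = x := by
  revert a x; decide

/-- `(x - a).val ≤ 3`. [folklore] -/
theorem sub_val_le_three (a x : Fin 4) : (x - a).val ≤ 3 := Nat.le_of_lt_succ (x - a).isLt

/-- The LEFT FAN at `z` from index `a`: the `n + 1` corners `(z, a), (z, a + 1), …, (z, a + n)`.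
[cite: Smirnov2010, §4] -/
def fanL (z : Site 2) : Fin 4 → ℕ → List (Site 2 × Fin 4)
  | a, 0 => [(z, a)]
  | a, n + 1 => (z, a) :: fanL z (a + 1) n

/-- The fan is nonempty. [folklore] -/
theorem fanL_ne_nil (z : Site 2) (a : Fin 4) (n : ℕ) : fanL z a n ≠ [] := by
  cases n <;> simp [fanL]

/-- The fan starts at `(z, a)`. [folklore] -/
theorem head?_fanL (z : Site 2) (a : Fin 4) (n : ℕ) : (fanL z a n).head? = some (z, a) := by
  cases n <;> rfl

/-- The fan ends at `(z, addN a n)`. [folklore] -/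
theorem getLast_fanL (z : Site 2) : ∀ (a : Fin 4) (n : ℕ),
    (fanL z a n).getLast (fanL_ne_nil z a n) = (z, addN a n)
  | a, 0 => by simp [fanL, addN]
  | a, n + 1 => by
    simp only [fanL, addN]
    rw [List.getLast_cons (fanL_ne_nil _ _ _), getLast_fanL z (a + 1) n]

/-- Every corner of the fan sits at `z`, with index among `a, …, a + n`. [folklore] -/
theorem mem_fanL {z : Site 2} : ∀ {a : Fin 4} {n : ℕ} {d : Site 2 × Fin 4}, d ∈ fanL z a n →
    d.1 = z ∧ ∃ i ≤ n, d.2 = addN a i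
  | a, 0, d, h => by
    simp only [fanL, List.mem_singleton] at h
    subst h
    exact ⟨rfl, 0, le_rfl, rfl⟩
  | a, n + 1, d, h => by
    simp only [fanL, List.mem_cons] at h
    rcases h with rfl | h
    · exact ⟨rfl, 0, Nat.zero_le _, rfl⟩
    · obtain ⟨h1, i, hi, h2⟩ := mem_fanL h
      exact ⟨h1, i + 1, by omega, h2⟩

/-- The fan is a chain of left turns. [folklore] -/
theorem isChain_fanL (z : Site 2) : ∀ (a : Fin 4) (n : ℕ), List.IsChain IsSucc (fanL z a n)
  | a, 0 => List.isChain_singleton _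
  | a, n + 1 => by
    rw [fanL]
    refine List.IsChain.cons (isChain_fanL z (a + 1) n) fun y hy => ?_
    rw [head?_fanL] at hy
    cases hy
    exact Or.inl rfl

/-- A fan of at most four corners has distinct corners. [folklore] -/
theorem nodup_fanL (z : Site 2) : ∀ (a : Fin 4) {n : ℕ}, n ≤ 3 → (fanL z a n).Nodup
  | a, 0, _ => List.nodup_singleton _
  | a, n + 1, hn => by
    rw [fanL, List.nodup_cons]
    refine ⟨fun h => ?_, nodup_fanL z (a + 1) (by omega)⟩
    obtain ⟨-, i, hi, h2⟩ := mem_fanL h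
    simp only at h2
    have key : ∀ a : Fin 4, a ≠ addN (a + 1) 0 ∧ a ≠ addN (a + 1) 1 ∧ a ≠ addN (a + 1) 2 := by decide
    have hi2 : i ≤ 2 := by omega
    interval_cases i
    · exact (key a).1 h2
    · exact (key a).2.1 h2
    · exact (key a).2.2 h2

/-! ### Corner walks -/

/-- **The corner walk** of the lattice path from `z` with direction list `ks`, entered at the arrival index
`a`: at the current vertex the left fan from `(z, a)` to the departure corner `(z, k + 3)`, then (right turn
along the `k`-th edge) the walk from `z + u_k` entered at `k + 2`. The arrival corner of the final vertex is
NOT emitted. [cite: DuminilCopinHonglerNolin2011, Lemma 12] -/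
def cornerWalk : Site 2 → Fin 4 → List (Fin 4) → List (Site 2 × Fin 4)
  | _, _, [] => []
  | z, a, k :: ks => fanL z a (k + 3 - a).val ++ cornerWalk (z + cornerUnit k) (k + 2) ks

/-- The vertices of the lattice path from `z` with direction list `ks`, the final vertex excluded.
[folklore] -/
def pathVerts : Site 2 → List (Fin 4) → List (Site 2)
  | _, [] => []
  | z, k :: ks => z :: pathVerts (z + cornerUnit k) ks

/-- The final vertex of the lattice path. [folklore] -/
def pathEnd : Site 2 → List (Fin 4) → Site 2
  | z, [] => z
  | z, k :: ks => pathEnd (z + cornerUnit k) ks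

/-- The walk of the empty direction list is empty. [folklore] -/
@[simp] theorem cornerWalk_nil (z : Site 2) (a : Fin 4) : cornerWalk z a [] = [] := rfl

/-- Unfolding one step of the walk. [folklore] -/
theorem cornerWalk_cons (z : Site 2) (a k : Fin 4) (ks : List (Fin 4)) :
    cornerWalk z a (k :: ks) = fanL z a (k + 3 - a).val ++ cornerWalk (z + cornerUnit k) (k + 2) ks := rfl

/-- A walk with at least one step is nonempty. [folklore] -/
theorem cornerWalk_ne_nil (z : Site 2) (a : Fin 4) {ks : List (Fin 4)} (hks : ks ≠ []) : cornerWalk z a ks ≠ [] := by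
  obtain ⟨k, ks, rfl⟩ := List.exists_cons_of_ne_nil hks
  rw [cornerWalk_cons]
  exact List.append_ne_nil_of_left_ne_nil (fanL_ne_nil _ _ _) _

/-- The walk starts at its arrival corner `(z, a)`. [folklore] -/
theorem head?_cornerWalk (z : Site 2) (a : Fin 4) {ks : List (Fin 4)} (hks : ks ≠ []) :
    (cornerWalk z a ks).head? = some (z, a) := by
  obtain ⟨k, ks, rfl⟩ := List.exists_cons_of_ne_nil hks
  rw [cornerWalk_cons, List.head?_append, head?_fanL]
  rfl

/-- The departure corner of a fan is followed, along the edge, by the arrival corner of the next vertex.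
[cite: Smirnov2010, §4] -/
theorem rightSucc_departure (z : Site 2) (k : Fin 4) : rightSucc (z, k + 3) = (z + cornerUnit k, k + 2) := by
  simp only [rightSucc, Prod.mk.injEq]
  have h1 : ∀ k : Fin 4, k + 3 + 1 = k := by decide
  have h2 : ∀ k : Fin 4, k + 3 + 3 = k + 2 := by decide
  exact ⟨by rw [h1], h2 k⟩

/-- The last corner of the fan at `z` towards direction `k` is the departure corner `(z, k + 3)`.
[folklore] -/
theorem getLast_fanL_departure (z : Site 2) (a k : Fin 4) :
    (fanL z a (k + 3 - a).val).getLast (fanL_ne_nil _ _ _) = (z, k + 3) := by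
  rw [getLast_fanL, addN_sub_val]

/-- The end vertex of a one-step extension. [folklore] -/
theorem pathEnd_append_singleton (z : Site 2) (ks : List (Fin 4)) (k : Fin 4) :
    pathEnd z (ks ++ [k]) = pathEnd z ks + cornerUnit k := by
  induction ks generalizing z with
  | nil => rfl
  | cons k₀ ks ih => simp [pathEnd, ih]

/-- **Walks concatenate**: the walk of `ks ++ [k] ++ ks'` is the walk of `ks ++ [k]` followed by the walk
of `ks'` from the end vertex, entered at `k + 2`. [folklore] -/
theorem cornerWalk_append (z : Site 2) (a : Fin 4) (ks : List (Fin 4)) (k : Fin 4) (ks' : List (Fin 4)) :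
    cornerWalk z a (ks ++ [k] ++ ks') = cornerWalk z a (ks ++ [k]) ++ cornerWalk (pathEnd z (ks ++ [k])) (k + 2) ks' := by
  induction ks generalizing z a with
  | nil => simp [cornerWalk_cons, pathEnd]
  | cons k₀ ks ih =>
    have := ih (z + cornerUnit k₀) (k₀ + 2)
    simp only [List.cons_append, cornerWalk_cons, pathEnd, List.append_assoc, List.nil_append] at this ⊢
    rw [this]

/-- **The walk is a chain of successors.** [cite: Smirnov2010, §4] -/
theorem isChain_cornerWalk (z : Site 2) (a : Fin 4) (ks : List (Fin 4)) : List.IsChain IsSucc (cornerWalk z a ks) := by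
  induction ks generalizing z a with
  | nil => exact List.isChain_nil
  | cons k ks ih =>
    rw [cornerWalk_cons]
    refine List.IsChain.append (isChain_fanL z a _) (ih _ _) fun x hx y hy => ?_
    rw [List.getLast?_eq_some_getLast (fanL_ne_nil _ _ _), Option.mem_def, Option.some.injEq,
      getLast_fanL_departure] at hx
    subst hx
    rcases ks with _ | ⟨k', ks'⟩
    · simp at hy
    · rw [head?_cornerWalk _ _ (List.cons_ne_nil _ _), Option.mem_def, Option.some.injEq] at hy
      subst hy
      exact Or.inr (rightSucc_departure z k).symm

/-- **The arrival corner at the end vertex continues the chain**: for a nonempty walk, the arrival corner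
`(pathEnd, k_last + 2)` is the right successor of the last corner. [cite: Smirnov2010, §4] -/
theorem isSucc_getLast_cornerWalk (z : Site 2) (a : Fin 4) (ks : List (Fin 4)) (k : Fin 4) :
    IsSucc ((cornerWalk z a (ks ++ [k])).getLast (cornerWalk_ne_nil z a (by simp)))
      (pathEnd z (ks ++ [k]), k + 2) := by
  induction ks generalizing z a with
  | nil =>
    right
    simp only [List.nil_append, cornerWalk_cons, cornerWalk_nil, List.append_nil, pathEnd]
    rw [getLast_fanL_departure, rightSucc_departure]
  | cons k₀ ks ih =>
    have hne : cornerWalk (z + cornerUnit k₀) (k₀ + 2) (ks ++ [k]) ≠ [] := cornerWalk_ne_nil _ _ (by simp)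
    simp only [List.cons_append, cornerWalk_cons, pathEnd]
    rw [List.getLast_append_of_ne_nil _ hne]
    exact ih _ _

/-- **Every corner of the walk sits at a non-final vertex of the path.** [folklore] -/
theorem fst_mem_pathVerts {z : Site 2} {a : Fin 4} {ks : List (Fin 4)} {d : Site 2 × Fin 4}
    (hd : d ∈ cornerWalk z a ks) : d.1 ∈ pathVerts z ks := by
  induction ks generalizing z a with
  | nil => simp at hd
  | cons k ks ih =>
    rw [cornerWalk_cons, List.mem_append] at hd
    rw [pathVerts, List.mem_cons]
    rcases hd with hd | hd
    · exact Or.inl (mem_fanL hd).1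
    · exact Or.inr (ih hd)

/-- **Distinct vertices give distinct corners.** [folklore] -/
theorem nodup_cornerWalk {z : Site 2} {a : Fin 4} {ks : List (Fin 4)} (h : (pathVerts z ks).Nodup) :
    (cornerWalk z a ks).Nodup := by
  induction ks generalizing z a with
  | nil => exact List.nodup_nil
  | cons k ks ih =>
    rw [pathVerts, List.nodup_cons] at h
    rw [cornerWalk_cons]
    refine List.Nodup.append (nodup_fanL z a (sub_val_le_three _ _)) (ih h.2) fun d hd hd' => ?_
    have h1 := (mem_fanL hd).1
    have h2 := fst_mem_pathVerts hd'
    rw [h1] at h2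
    exact h.1 h2

/-! ### Signed turns along a corner list -/

/-- The turn sign from `a` to its successor `b`: `-1` for the right successor, `+1` otherwise.
[cite: Smirnov2010, §4] -/
noncomputable def sgn (a b : Site 2 × Fin 4) : ℤ := by classical exact if b = rightSucc a then -1 else 1

/-- The signed number of quarter turns along the corner list `L` continued by `next`: the sum of the turn
signs of consecutive pairs of `L ++ [next]`. [cite: Smirnov2010, §4] -/
noncomputable def walkSign : List (Site 2 × Fin 4) → Site 2 × Fin 4 → ℤ
  | [], _ => 0
  | [a], next => sgn a next
  | a :: b :: rest, next => sgn a b + walkSign (b :: rest) next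

/-- `walkSign` of a cons with nonempty tail. [folklore] -/
theorem walkSign_cons_of_ne_nil (a : Site 2 × Fin 4) {L : List (Site 2 × Fin 4)} (hL : L ≠ []) (next : Site 2 × Fin 4)
    (b : Site 2 × Fin 4) (hb : L.head? = some b) : walkSign (a :: L) next = sgn a b + walkSign L next := by
  obtain ⟨b', rest, rfl⟩ := List.exists_cons_of_ne_nil hL
  simp only [List.head?_cons, Option.some.injEq] at hb
  subst hb
  rfl

/-- **`walkSign` is additive under concatenation** (the junction turn goes with the first list). [folklore] -/
theorem walkSign_append : ∀ (L₁ : List (Site 2 × Fin 4)) {L₂ : List (Site 2 × Fin 4)} (b : Site 2 × Fin 4)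
    (_ : L₂.head? = some b) (next : Site 2 × Fin 4), walkSign (L₁ ++ L₂) next = walkSign L₁ b + walkSign L₂ next
  | [], L₂, b, hb, next => by simp [walkSign]
  | [a], L₂, b, hb, next => by
    have hL₂ : L₂ ≠ [] := by rintro rfl; simp at hb
    rw [List.singleton_append, walkSign_cons_of_ne_nil a hL₂ next b hb]
    rfl
  | a :: a' :: rest, L₂, b, hb, next => by
    have ih := walkSign_append (a' :: rest) b hb next
    simp only [List.cons_append] at ih ⊢
    rw [walkSign, ih, walkSign]
    ring

/-- A left step has sign `+1`. [folklore] -/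
theorem sgn_leftSucc (a : Site 2 × Fin 4) : sgn a (leftSucc a) = 1 := by
  classical
  unfold sgn; rw [if_neg (leftSucc_ne_rightSucc a)]

/-- A right step has sign `-1`. [folklore] -/
theorem sgn_rightSucc (a : Site 2 × Fin 4) : sgn a (rightSucc a) = -1 := by
  classical
  unfold sgn; rw [if_pos rfl]

/-- **The sign of a fan followed by its right turn**: `n` left turns and one right turn, `n - 1`. [folklore] -/
theorem walkSign_fanL (z : Site 2) : ∀ (a : Fin 4) (n : ℕ),
    walkSign (fanL z a n) (rightSucc (z, addN a n)) = (n : ℤ) - 1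
  | a, 0 => by simp [fanL, walkSign, addN, sgn_rightSucc]
  | a, n + 1 => by
    rw [fanL, walkSign_cons_of_ne_nil _ (fanL_ne_nil _ _ _) _ _ (head?_fanL _ _ _), addN]
    change sgn (z, a) (leftSucc (z, a)) + _ = _
    rw [sgn_leftSucc, walkSign_fanL z (a + 1) n]
    push_cast; ring

/-- The signed turns of the walk entered at `a` with direction list `ks`, vertex by vertex: at each vertex
`(k + 3 - a).val` left turns (from the arrival index `a` to the departure index `k + 3`) and one right turn.
[folklore] -/
def walkTurns : Fin 4 → List (Fin 4) → ℤ
  | _, [] => 0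
  | a, k :: ks => (((k + 3 - a).val : ℕ) : ℤ) - 1 + walkTurns (k + 2) ks

/-- The last direction of a nonempty direction list (junk `0` for the empty list). [folklore] -/
def lastDir (ks : List (Fin 4)) : Fin 4 := ks.getLastD 0

/-- **The signed turns of a corner walk**, continued by the arrival corner at its end vertex, are
`walkTurns a ks`. [folklore] -/
theorem walkSign_cornerWalk (z : Site 2) (a : Fin 4) : ∀ {ks : List (Fin 4)}, ks ≠ [] →
    walkSign (cornerWalk z a ks) (pathEnd z ks, lastDir ks + 2) = walkTurns a ks := by
  intro ks hks
  induction ks generalizing z a with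
  | nil => exact absurd rfl hks
  | cons k ks ih =>
    rw [cornerWalk_cons, walkTurns]
    rcases ks with _ | ⟨k', ks'⟩
    · simp only [cornerWalk_nil, List.append_nil, pathEnd, lastDir, List.getLastD_cons, List.getLastD_nil, walkTurns,
        add_zero]
      rw [← rightSucc_departure, show (z, k + 3) = (z, addN a (k + 3 - a).val) by rw [addN_sub_val], walkSign_fanL]
    · rw [walkSign_append _ _ (head?_cornerWalk _ _ (List.cons_ne_nil _ _)), ← ih _ _ (List.cons_ne_nil _ _)]
      simp only [pathEnd, lastDir, List.getLastD_cons]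
      congr 1
      rw [show ((z + cornerUnit k, k + 2) : Site 2 × Fin 4) = rightSucc (z, addN a (k + 3 - a).val) by
        rw [addN_sub_val, rightSucc_departure], walkSign_fanL]

/-- **A straight run entered straight contributes no net turn**: `walkTurns (k + 2) (replicate n k) = 0`.
[folklore] -/
theorem walkTurns_replicate (k : Fin 4) : ∀ n : ℕ, walkTurns (k + 2) (List.replicate n k) = 0
  | 0 => rfl
  | n + 1 => by
    rw [List.replicate_succ, walkTurns, walkTurns_replicate k n]
    have : ∀ k : Fin 4, ((k + 3 - (k + 2)).val : ℕ) = 1 := by decide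
    rw [this]; norm_num

/-- `walkTurns` is additive under concatenation of direction lists. [folklore] -/
theorem walkTurns_append : ∀ (a : Fin 4) (ks : List (Fin 4)) (k : Fin 4) (ks' : List (Fin 4)),
    walkTurns a (ks ++ [k] ++ ks') = walkTurns a (ks ++ [k]) + walkTurns (k + 2) ks'
  | a, [], k, ks' => by simp [walkTurns]
  | a, k₀ :: ks, k, ks' => by
    simp only [List.cons_append, walkTurns]
    have := walkTurns_append (k₀ + 2) ks k ks'
    simp only [List.append_assoc, List.singleton_append] at this ⊢
    rw [this]; ring

/-! ### Medial coordinates of the corners at a vertex -/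

/-- **Medial coordinates of a corner at `v`**: `cpos (v, k) = (v₀ + v₁ - ε, v₁ - v₀ + ε')` with
`ε, ε' ∈ {0, 1}`. [cite: Smirnov2010, §4, Fig. 5] -/
theorem cpos_fst_bounds (p : Site 2 × Fin 4) :
    p.1 0 + p.1 1 - 1 ≤ (cpos p).1 ∧ (cpos p).1 ≤ p.1 0 + p.1 1 ∧
      p.1 1 - p.1 0 ≤ (cpos p).2 ∧ (cpos p).2 ≤ p.1 1 - p.1 0 + 1 := by
  obtain ⟨v, k⟩ := p
  simp only [cpos]
  fin_cases k <;> simp [cposOff]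

/-- The corner `(v, 0)` has medial coordinates `(v₀ + v₁, v₁ - v₀)` exactly. [cite: Smirnov2010, §4, Fig. 5] -/
theorem cpos_zero (v : Site 2) : cpos (v, 0) = (v 0 + v 1, v 1 - v 0) := by
  simp [cpos, cposOff]

/-- The corner `(v, 2)` has medial coordinates `(v₀ + v₁ - 1, v₁ - v₀ + 1)` exactly. [cite: Smirnov2010, §4, Fig. 5] -/
theorem cpos_two (v : Site 2) : cpos (v, 2) = (v 0 + v 1 - 1, v 1 - v 0 + 1) := by
  simp only [cpos, cposOff, Matrix.cons_val, Prod.mk.injEq, and_true]; omega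

end Literature.Probability.LatticeModels
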